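import Summits.CriticalPhenomena.SAWScalingLimit.Theses.SAWRestrictionRigidity
import Summits.CriticalPhenomena.SAWScalingLimit.Theorems.SAWRestrictionRigidityRigidityClosureHomeomorph
import Literature.Probability.RandomPlanarGeometry.ConformalMapRiemannProofs
import Literature.Probability.RandomPlanarGeometry.ConformalMapCaratheodoryProofs
import Literature.Probability.RandomPlanarGeometry.JordanDomainProofs
import Literature.Probability.RandomPlanarGeometry.DiscRectangles
import Literature.Probability.RandomPlanarGeometry.ConformalRestrictionProofs

/-!
# Stub `stub_dpCovarianceOfDisc` of line `registered` (v6, the mark-fixing cut), crux `Rigidity` (stmt-CriticalPhenomena-1368), route SAWRestrictionRigidity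

Target: `Summits/CriticalPhenomena/SAWScalingLimit/Theorems/SAWRestrictionRigidityRigidityDpCovarianceOfDisc.lean`
(`--supports stmt-CriticalPhenomena-1368`).

**From discs to all domains, direction-preserving form.** If the laws `P D₀` of two-marked unit
discs `D₀` (carrier `Metric.ball 0 1`) transport correctly, `P D' = Φ_* P D₀`, along every
`Φ : C(ℂ, ℂ)` complex differentiable on the open disc, injective on the closed disc and
DIRECTION-PRESERVING on the marks (`Φ b - Φ a = r (b - a)`, `r > 0`), then `P` is covariant under
every conformal equivalence `g : D → D'` of Dobrushin domains with the marks as boundary values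
whose mark pairs are direction-parallel, `b' - a' = r (b - a)`, `r > 0`. No axiom on `P` is used.

Proof. The closure-homeomorphism lemma (`Cocycle.stub_closureHomeomorph`) makes the continuous
plane map `Φ` (agreeing with `g` on `D`) injective on `closure D` with `Φ '' D = D'`, `Φ a = a'`,
`Φ b = b'`. The Riemann mapping theorem (`exists_conformalEquiv_ball_holds`) and Carathéodory's
theorem (`JordanDomain.exists_continuousOn_extension_holds`) give a continuous bijection
`Ψ₀ : 𝔻̄ → D̄` conformal inside, circle onto `∂D`; the marks `a, b` have distinct preimages
`p₀, q₀` on the circle. NEW STEP: pre-rotate the disc by the unit complex number `ω` with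
`b - a = s ω (q₀ - p₀)`, `s > 0`, i.e. replace `Ψ₀` by `Ψ₁ z = Ψ₀ (ω⁻¹ z)` and the preimages by
`p = ω p₀`, `q = ω q₀`, so that `b - a = s (q - p)`. Mark the disc at `p, q`
(`JordanDomain.rotUnitDisc`), extend `Ψ₁` to a continuous plane map `Ψ` (Tietze). Then
`Ψ : (𝔻; p, q) → (D; a, b)` and `Φ ∘ Ψ : (𝔻; p, q) → (D'; a', b')` are both direction-preserving
(factors `s` and `r s`), so the hypothesis gives `P D = Ψ_* P 𝔻` and
`P D' = (Φ ∘ Ψ)_* P 𝔻 = Φ_* Ψ_* P 𝔻 = Φ_* P D` (`Measure.map_map`, `CurveClass.map_map`).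

References: L. V. Ahlfors, *Complex Analysis* (1979), Ch. 6 §1.1 Thm. 1 (Riemann mapping
theorem); Ch. Pommerenke, *Boundary Behaviour of Conformal Maps* (1992), Thm. 2.6
(Carathéodory); G. F. Lawler, *Conformally Invariant Processes in the Plane* (2005), §6.1
(transport of chordal laws by conformal maps).
-/

noncomputable section

namespace Summit.CriticalPhenomena.SAWScalingLimit.Cruxes.Rigidity.MarkFixing

open MeasureTheory Set Filter Topology Metric
open Literature.Probability.RandomPlanarGeometry

/-- **Two-marked unit discs with prescribed marks** (copied from p168637,
`Dichotomy.stub_discUniformization`, where it is private). For distinct points `p, q` of the unit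
circle there is a Dobrushin domain with carrier the open unit disc and marked points `p`, `q`: the
disc with boundary loop `t ↦ e^{i(2πt + θ)}` started at `p = e^{iθ}` (`JordanDomain.rotUnitDisc θ`),
marked at the parameters `0` and `s ∈ (0, 1)` of `p` and `q`. [folklore] -/
private theorem exists_markedDisc_pt_eq {p q : ℂ} (hp : p ∈ sphere (0 : ℂ) 1)
    (hq : q ∈ sphere (0 : ℂ) 1) (hpq : p ≠ q) :
    ∃ D₁ : DobrushinDomain, D₁.carrier = ball 0 1 ∧ D₁.pt 0 = p ∧ D₁.pt 1 = q := by
  have hp' : p ∈ range (circleMap 0 1) := by rwa [range_circleMap, abs_one]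
  obtain ⟨θ, rfl⟩ := hp'
  have hq' : q ∈ frontier (JordanDomain.rotUnitDisc θ).carrier := by
    rwa [JordanDomain.rotUnitDisc_carrier, frontier_ball (0 : ℂ) one_ne_zero]
  rw [JordanDomain.frontier_eq_image_Ico] at hq'
  obtain ⟨s, hs, hsq⟩ := hq'
  have h0 : (JordanDomain.rotUnitDisc θ).boundary 0 = circleMap 0 1 θ := by
    show circleMap 0 1 (2 * Real.pi * 0 + θ) = _
    rw [mul_zero, zero_add]
  have hs0 : 0 < s := by
    refine lt_of_le_of_ne hs.1 fun h ↦ hpq ?_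
    rw [← h0, ← hsq, ← h]
  refine ⟨{ toJordanDomain := JordanDomain.rotUnitDisc θ
            mark := ![0, s]
            strictMono_mark := ?_
            mark_mem := ?_ }, rfl, h0, hsq⟩
  · refine Fin.strictMono_iff_lt_succ.2 fun k ↦ ?_
    fin_cases k
    simpa using hs0
  · intro k
    fin_cases k
    · simp
    · simpa using hs

/-- **Aligning rotation.** For nonzero complex numbers `c, d` there are a unit complex number `ω`
and a real `s > 0` with `c = s ω d` (take `ω = (c/d)/|c/d|`, `s = |c/d|`). [folklore] -/
private theorem exists_unit_mul_eq {c d : ℂ} (hc : c ≠ 0) (hd : d ≠ 0) :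
    ∃ ω : ℂ, ‖ω‖ = 1 ∧ ∃ s : ℝ, 0 < s ∧ c = (s : ℂ) * (ω * d) := by
  have hv : c / d ≠ 0 := div_ne_zero hc hd
  have hn : (‖c / d‖ : ℂ) ≠ 0 := by exact_mod_cast norm_ne_zero_iff.2 hv
  refine ⟨(‖c / d‖ : ℂ)⁻¹ * (c / d), ?_, ‖c / d‖, norm_pos_iff.2 hv, ?_⟩
  · rw [norm_mul, norm_inv, Complex.norm_real, norm_norm,
      inv_mul_cancel₀ (norm_ne_zero_iff.2 hv)]
  · symm
    rw [mul_assoc, mul_inv_cancel_left₀ hn, div_mul_cancel₀ c hd]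

/-- stub B3 (bookkeeping, M; from discs to all domains, direction-preserving form, NO axiom used): if the laws of two-marked unit discs transport along every direction-preserving `Φ : C(ℂ, ℂ)` conformal on the open disc and injective on the closed disc, then `P` is covariant under every conformal equivalence of Dobrushin domains with the marks as boundary values whose mark pairs are direction-parallel, `b' - a' = r (b - a)`, `r > 0`. Proof as p168637 (`Dichotomy.stub_discUniformization`: Riemann map `exists_conformalEquiv_ball_holds`, Carathéodory `JordanDomain.exists_continuousOn_extension_holds`, Tietze) with ONE extra step: pre-rotate the disc (`Ψ₀ ∘ (ω⁻¹ ·)`, `|ω| = 1`) so that the preimages `p, q` of the marks satisfy `(q - p)/|q - p| = (b - a)/|b - a|`; then `Ψ : (𝔻; p, q) → (D; a, b)` and `Φ ∘ Ψ : (𝔻; p, q) → (D'; a', b')` are both direction-preserving (`Φ a = a'`, `Φ b = b'`, `Φ` injective on `closure D` by the closure homeomorphism p148398 `Cocycle.stub_closureHomeomorph`), and `P D' = (Φ Ψ)_* P 𝔻 = Φ_* P D`. [folklore] -/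
theorem stub_dpCovarianceOfDisc : ∀ P : Literature.Probability.RandomPlanarGeometry.ChordalFamily, (∀ (D₀ D' : Literature.Probability.RandomPlanarGeometry.DobrushinDomain) (Φ : C(ℂ, ℂ)), D₀.carrier = Metric.ball 0 1 → DifferentiableOn ℂ Φ D₀.carrier → Set.InjOn Φ (closure D₀.carrier) → (∃ r : ℝ, 0 < r ∧ Φ (D₀.pt 1) - Φ (D₀.pt 0) = (r : ℂ) * (D₀.pt 1 - D₀.pt 0)) → D'.carrier = Φ '' D₀.carrier → D'.pt 0 = Φ (D₀.pt 0) → D'.pt 1 = Φ (D₀.pt 1) → P D' = (P D₀).map (Literature.Probability.RandomPlanarGeometry.CurveClass.map Φ)) → ∀ (D D' : Literature.Probability.RandomPlanarGeometry.DobrushinDomain) (g : Literature.Probability.RandomPlanarGeometry.ConformalEquiv D.carrier D'.carrier) (Φ : C(ℂ, ℂ)), g.HasBoundaryValue (D.pt 0) (D'.pt 0) → g.HasBoundaryValue (D.pt 1) (D'.pt 1) → Set.EqOn Φ g D.carrier → (∃ r : ℝ, 0 < r ∧ D'.pt 1 - D'.pt 0 = (r : ℂ) * (D.pt 1 - D.pt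 0)) → P D' = (P D).map (Literature.Probability.RandomPlanarGeometry.CurveClass.map Φ) := by
  intro P hdisc D D' g Φ h0 h1 hEq hdir
  obtain ⟨r, hr, hdir⟩ := hdir
  -- (0) `Φ` on the closure of `D` (closure homeomorphism of `g`)
  obtain ⟨hΦi, himD, -, -, ha, hb, -, -⟩ := Cocycle.stub_closureHomeomorph D D' g Φ h0 h1 hEq
  have hΦd : DifferentiableOn ℂ Φ D.carrier := g.differentiableOn_coe.congr hEq
  -- (1) Riemann map of the disc onto `D`
  obtain ⟨φ⟩ := exists_conformalEquiv_ball_holds (U := D.carrier) D.isOpen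
    D.toJordanDomain.isSimplyConnected_carrier D.toJordanDomain.carrier_ne_univ
  have ψ : ConformalEquiv (ball (0 : ℂ) 1) D.carrier := φ.symm
  -- (2) its Carathéodory extension to the closed disc
  obtain ⟨Ψ₀, hΨ₀c, hΨ₀e, hΨ₀bij, hΨ₀bij'⟩ :=
    JordanDomain.exists_continuousOn_extension_holds D.toJordanDomain ψ
  -- (3) the preimages of the marks on the circle
  obtain ⟨p₀, hp₀, hpa⟩ := hΨ₀bij'.surjOn (D.pt_mem_frontier 0)
  obtain ⟨q₀, hq₀, hqb⟩ := hΨ₀bij'.surjOn (D.pt_mem_frontier 1)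
  have hab : D.pt 0 ≠ D.pt 1 := fun h ↦ absurd (D.pt_injective h) (by decide)
  have hpq₀ : p₀ ≠ q₀ := by
    rintro rfl
    exact hab (hpa.symm.trans hqb)
  -- (4) the aligning rotation `z ↦ ω⁻¹ z` of the disc and the rotated preimages `ω p₀`, `ω q₀`
  obtain ⟨ω, hω1, s, hs, hsdir⟩ :=
    exists_unit_mul_eq (sub_ne_zero.2 hab.symm) (sub_ne_zero.2 hpq₀.symm)
  have hω0 : ω ≠ 0 := norm_ne_zero_iff.1 (by rw [hω1]; exact one_ne_zero)
  have hnorm : ∀ z : ℂ, ‖ω⁻¹ * z‖ = ‖z‖ := fun z ↦ by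
    rw [norm_mul, norm_inv, hω1, inv_one, one_mul]
  have hnorm' : ∀ z : ℂ, ‖ω * z‖ = ‖z‖ := fun z ↦ by rw [norm_mul, hω1, one_mul]
  have hRb : MapsTo (fun z : ℂ ↦ ω⁻¹ * z) (ball 0 1) (ball 0 1) := fun z hz ↦ by
    simpa only [mem_ball_zero_iff, hnorm] using hz
  have hRcb : MapsTo (fun z : ℂ ↦ ω⁻¹ * z) (closedBall 0 1) (closedBall 0 1) := fun z hz ↦ by
    simpa only [mem_closedBall_zero_iff, hnorm] using hz
  have hRim : (fun z : ℂ ↦ ω⁻¹ * z) '' ball 0 1 = ball 0 1 := by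
    refine hRb.image_subset.antisymm fun z hz ↦ ⟨ω * z, ?_, inv_mul_cancel_left₀ hω0 z⟩
    simpa only [mem_ball_zero_iff, hnorm'] using hz
  have hRinj : (fun z : ℂ ↦ ω⁻¹ * z).Injective := mul_right_injective₀ (inv_ne_zero hω0)
  have hp : ω * p₀ ∈ sphere (0 : ℂ) 1 := by
    simpa only [mem_sphere_zero_iff_norm, hnorm'] using hp₀
  have hq : ω * q₀ ∈ sphere (0 : ℂ) 1 := by
    simpa only [mem_sphere_zero_iff_norm, hnorm'] using hq₀
  have hpq : ω * p₀ ≠ ω * q₀ := fun h ↦ hpq₀ (mul_left_cancel₀ hω0 h)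
  -- the two-marked disc `D₁ = (𝔻; ω p₀, ω q₀)`, direction-parallel to `(D; a, b)`
  obtain ⟨D₁, hD₁c, hD₁0, hD₁1⟩ := exists_markedDisc_pt_eq hp hq hpq
  have hqp : D.pt 1 - D.pt 0 = (s : ℂ) * (D₁.pt 1 - D₁.pt 0) := by
    rw [hD₁1, hD₁0, ← mul_sub]
    exact hsdir
  -- (5) the rotated Carathéodory extension and its continuous extension to the plane (Tietze)
  have hΨ₁c : ContinuousOn (fun z : ℂ ↦ Ψ₀ (ω⁻¹ * z)) (closedBall 0 1) :=
    hΨ₀c.comp (continuous_const_mul ω⁻¹).continuousOn hRcb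
  obtain ⟨Ψ, hΨ⟩ := ContinuousMap.exists_restrict_eq (Y := ℂ) isClosed_closedBall
    ⟨(closedBall (0 : ℂ) 1).restrict fun z : ℂ ↦ Ψ₀ (ω⁻¹ * z),
      continuousOn_iff_continuous_restrict.1 hΨ₁c⟩
  have hΨeq : EqOn Ψ (fun z : ℂ ↦ Ψ₀ (ω⁻¹ * z)) (closedBall 0 1) := fun x hx ↦ by
    simpa using ContinuousMap.congr_fun hΨ ⟨x, hx⟩
  have hΨball : EqOn Ψ (ψ ∘ fun z : ℂ ↦ ω⁻¹ * z) (ball 0 1) := fun x hx ↦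
    (hΨeq (ball_subset_closedBall hx)).trans (hΨ₀e (hRb hx))
  -- (6) `P D = Ψ_* P D₁`
  have hcl : closure D₁.carrier = closedBall (0 : ℂ) 1 := by
    rw [hD₁c, closure_ball 0 one_ne_zero]
  have hΨd : DifferentiableOn ℂ Ψ D₁.carrier := by
    rw [hD₁c]
    exact (ψ.differentiableOn_coe.comp (differentiableOn_id.const_mul _) hRb).congr hΨball
  have hΨi : InjOn Ψ (closure D₁.carrier) := by
    rw [hcl]
    exact hΨeq.injOn_iff.2 (hΨ₀bij.injOn.comp hRinj.injOn hRcb)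
  have hΨim : Ψ '' D₁.carrier = D.carrier := by
    rw [hD₁c, hΨball.image_eq, image_comp, hRim, ψ.bijOn.image_eq]
  have hΨ0 : Ψ (D₁.pt 0) = D.pt 0 := by
    rw [hD₁0, hΨeq (sphere_subset_closedBall hp)]
    show Ψ₀ (ω⁻¹ * (ω * p₀)) = _
    rw [inv_mul_cancel_left₀ hω0, hpa]
  have hΨ1 : Ψ (D₁.pt 1) = D.pt 1 := by
    rw [hD₁1, hΨeq (sphere_subset_closedBall hq)]
    show Ψ₀ (ω⁻¹ * (ω * q₀)) = _
    rw [inv_mul_cancel_left₀ hω0, hqb]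
  have hΨdir : ∃ r : ℝ, 0 < r ∧ Ψ (D₁.pt 1) - Ψ (D₁.pt 0) = (r : ℂ) * (D₁.pt 1 - D₁.pt 0) :=
    ⟨s, hs, by rw [hΨ1, hΨ0]; exact hqp⟩
  have h₁ : P D = (P D₁).map (CurveClass.map Ψ) :=
    hdisc D₁ D Ψ hD₁c hΨd hΨi hΨdir hΨim.symm hΨ0.symm hΨ1.symm
  -- (7) `P D' = (Φ ∘ Ψ)_* P D₁`
  have hmaps : MapsTo Ψ D₁.carrier D.carrier := hΨim ▸ mapsTo_image Ψ D₁.carrier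
  have hmaps' : MapsTo Ψ (closure D₁.carrier) (closure D.carrier) := by
    rw [hcl]
    exact hΨeq.mapsTo_iff.2 (hΨ₀bij.mapsTo.comp hRcb)
  have hΦΨd : DifferentiableOn ℂ (Φ.comp Ψ) D₁.carrier := by
    rw [ContinuousMap.coe_comp]
    exact hΦd.comp hΨd hmaps
  have hΦΨi : InjOn (Φ.comp Ψ) (closure D₁.carrier) := by
    rw [ContinuousMap.coe_comp]
    exact hΦi.comp hΨi hmaps'
  have hΦΨim : D'.carrier = (Φ.comp Ψ) '' D₁.carrier := by
    rw [ContinuousMap.coe_comp, image_comp, hΨim, himD]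
  have hΦΨ0 : D'.pt 0 = (Φ.comp Ψ) (D₁.pt 0) := by
    rw [ContinuousMap.comp_apply, hΨ0, ha]
  have hΦΨ1 : D'.pt 1 = (Φ.comp Ψ) (D₁.pt 1) := by
    rw [ContinuousMap.comp_apply, hΨ1, hb]
  have hΦΨdir : ∃ r : ℝ, 0 < r ∧
      (Φ.comp Ψ) (D₁.pt 1) - (Φ.comp Ψ) (D₁.pt 0) = (r : ℂ) * (D₁.pt 1 - D₁.pt 0) :=
    ⟨r * s, mul_pos hr hs, by
      rw [← hΦΨ1, ← hΦΨ0, hdir, hqp, Complex.ofReal_mul, mul_assoc]⟩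
  have h₂ : P D' = (P D₁).map (CurveClass.map (Φ.comp Ψ)) :=
    hdisc D₁ D' (Φ.comp Ψ) hD₁c hΦΨd hΦΨi hΦΨdir hΦΨim hΦΨ0 hΦΨ1
  -- (8) functoriality of push-forwards
  have hcomp : CurveClass.map (Φ.comp Ψ) = CurveClass.map Φ ∘ CurveClass.map Ψ :=
    funext fun c ↦ (CurveClass.map_map Ψ Φ c).symm
  rw [h₂, h₁, Measure.map_map (CurveClass.measurable_map Φ) (CurveClass.measurable_map Ψ), hcomp]

end Summit.CriticalPhenomena.SAWScalingLimit.Cruxes.Rigidity.MarkFixing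

end
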